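import Summits.BirchSwinnertonDyer.Rank1Residual.Additive.RamifiedOrdinaryLineUniqueModelFree
import Mathlib.NumberTheory.Multiplicity
import HarnessLib

/-!
# Finite-order automorphisms of a corank-one divisible `p`-group that are trivial on its `p`-torsion
# are trivial (`p` odd) — the kernel form of "the torsion of `Aut(ℚ_p/ℤ_p) = ℤ_pˣ` is `μ_{p−1}`,
# which acts faithfully on the `p`-torsion" (cell `b2b-bsdres`, team n1011, seat p12 (gen 6); row
# T-GV29-MF FILE A1, the GENERIC algebra behind `RamifiedOrdinaryLineQuotientInvariantsModelFree`)

HONEST FRAMING (cell `b2b-bsdres`, run/shared/lean/b2b/bsd-rank1-residual/, verbatim in every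
file): the goal of the cell is to DELETE the COMBINATION-SHAPED residual classes of the
Birch–Swinnerton-Dyer formula for ALL analytic-rank `≤ 1` elliptic curves over `ℚ` — "full BSD
formula for every rank `≤ 1` curve in class `C`" assembled STRICTLY from published theorems — so
that the rank-`≤ 1` remainder becomes exactly the CONSTRUCTION-SHAPED classes, which are TYPED
(missing-input `Prop`s), NOT attempted. This is not "finishing BSD". Team n1011: research routes on
CONSTRUCTION-SHAPED classes; prove what is provable now; no claim beyond stated classes; census
output = EVIDENCE, never a Literature fact; RESIDUAL-MAP marks UNCHANGED; nothing is booked by this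
file. THEOREMS ONLY, GENERIC GROUP THEORY (no curve): no definition, no named fact; cc-typer-2's
generator lemmas (`RamifiedOrdinaryLineUniqueModelFree` §1) consumed BY NAME.

## What

`G` a group acting on an additive commutative group `D` by group automorphisms
(`DistribMulAction G D`), `p` a prime, `D` `p`-PRIMARY (`∀ d, ∃ k, p^k d = 0`):

* (L1) `eq_zero_of_smul_eq_self_of_torsionBy` — if the only `p`-torsion element fixed by `g` is `0`,
  the only element fixed by `g` is `0` ("`(g − 1)` injective on `D[p]` ⇒ `D^g = 0`");
* (L2) `smul_eq_self_of_pow_smul_eq_self_of_not_dvd` — `g` trivial on `D[p]`, `gⁿ = 1` with `p ∤ n`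
  ⇒ `g = 1` (induction on the level: `x = g d − d` is `p`-torsion, hence fixed, `gⁿ d = d + n x`);
* (L3) `smul_eq_self_of_prime_pow_smul_eq_self` — `p` ODD, `D` moreover `p`-DIVISIBLE with
  `#D[p] = p` (so `D[p^K]` is cyclic of order `p^K` for every `K`, cc-typer-2's
  `exists_generator_of_pDivisible_of_natCard`): `g` trivial on `D[p]`, `g^{p^a} = 1` ⇒ `g = 1` — on a
  generator `P` of `D[p^K]`, `g P = u P` with `u ≡ 1 (mod p)` and `u^{p^a} ≡ 1 (mod p^K)`, and
  LIFTING THE EXPONENT (Mathlib `Int.emultiplicity_pow_sub_pow`, odd `p`) gives `u ≡ 1 (mod p^{K−a})`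
  (false at `p = 2`: `u = −1`);
* (L4) `smul_eq_self_of_pow_smul_eq_self` — (L2) + (L3): any `n ≥ 1`;
* `eq_zero_of_torsionBy_of_smul_eq_self` — with `#D[p] = p`: an element moving ONE `p`-torsion
  point fixes NO non-zero `p`-torsion point (`D[p]` cyclic of prime order).

Customer: `RamifiedOrdinaryLineQuotientInvariantsModelFree` (same row), where `D = E[p^∞]/C` for a
ramified ordinary line `C` and `g` an inertia element. References: Serre, *Cours d'arithmétique*,
II §3.1–3.2 (structure of `ℤ_pˣ`); here everything is proved on the group `D` without coordinates.
-/

set_option autoImplicit false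

noncomputable section

open scoped Classical AddSubgroup

namespace Summit.BirchSwinnertonDyer.Rank1Residual.Additive.CorankOneFiniteOrderAutomorphism

/-! ## §1. Generic `p`-group algebra: finite-order automorphisms trivial on `D[p]` -/

section Generic

variable (p : ℕ) [hp : Fact p.Prime] {G : Type*} [Group G] {D : Type*} [AddCommGroup D]
  [DistribMulAction G D]

/-- If `g` fixes `d` then every power of `g` fixes `d`. [folklore] -/
theorem pow_smul_eq_self_of_smul_eq_self {g : G} {d : D} (h : g • d = d) (j : ℕ) :
    g ^ j • d = d := by
  induction j with
  | zero => rw [pow_zero, one_smul]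
  | succ j ih => rw [pow_succ, mul_smul, h, ih]

omit hp in
/-- **(L1) `(g − 1)` injective on `D[p]` ⇒ `D^g = 0`** for a `p`-primary `D`: if the only `p`-torsion
element fixed by `g` is `0`, then the only element of `D` fixed by `g` is `0` (the last non-zero
multiple `p^k d` of a fixed `d` is a fixed `p`-torsion element). [folklore] -/
theorem eq_zero_of_smul_eq_self_of_torsionBy (hD : ∀ d : D, ∃ k : ℕ, p ^ k • d = 0) {g : G}
    (hinj : ∀ x : D, p • x = 0 → g • x = x → x = 0) {d : D} (hd : g • d = d) : d = 0 := by
  obtain ⟨k, hk⟩ := hD d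
  induction k generalizing d with
  | zero => rwa [pow_zero, one_nsmul] at hk
  | succ k ih =>
    have hx : p ^ k • d = 0 := by
      refine hinj (p ^ k • d) ?_ ?_
      · rw [← mul_nsmul', ← pow_succ', hk]
      · rw [smul_comm, hd]
    exact ih hd hx

/-- **(L2) coprime order:** `g` trivial on `D[p]`, `g^n = 1` on `D` with `p ∤ n`, `D` `p`-primary ⇒
`g = 1` on `D` (induction on the level: `x = g d − d` is `p`-torsion, hence fixed, so
`g^n d = d + n x`, so `n x = 0 = p x`, so `x = 0`). [folklore] -/
theorem smul_eq_self_of_pow_smul_eq_self_of_not_dvd (hD : ∀ d : D, ∃ k : ℕ, p ^ k • d = 0) {g : G}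
    (htriv : ∀ x : D, p • x = 0 → g • x = x) {n : ℕ} (hn : ¬ p ∣ n)
    (hgn : ∀ d : D, g ^ n • d = d) (d : D) : g • d = d := by
  obtain ⟨k, hk⟩ := hD d
  induction k generalizing d with
  | zero =>
    rw [pow_zero, one_nsmul] at hk
    rw [hk, smul_zero]
  | succ k ih =>
    -- `x := g d − d` is `p`-torsion, hence fixed by `g`
    set x : D := g • d - d with hxdef
    have hpd : g • (p • d) = p • d := ih (p • d) (by rw [← mul_nsmul', ← pow_succ, hk])
    have hpx : p • x = 0 := by rw [hxdef, nsmul_sub, ← smul_comm, hpd, sub_self]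
    have hgx : g • x = x := htriv x hpx
    -- `g^j d = d + j x`
    have hiter : ∀ j : ℕ, g ^ j • d = d + j • x := by
      intro j
      induction j with
      | zero => rw [pow_zero, one_smul, zero_nsmul, add_zero]
      | succ j ihj =>
        rw [pow_succ', mul_smul, ihj, smul_add, smul_comm, hgx, succ_nsmul, hxdef]
        abel
    have hnx : n • x = 0 := by
      have h := hgn d
      rw [hiter n, add_eq_left] at h
      exact h
    -- `n x = 0 = p x` with `p ∤ n` forces `x = 0`
    have hx0 : x = 0 := by
      have h1 : addOrderOf x ∣ p := addOrderOf_dvd_of_nsmul_eq_zero hpx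
      have h2 : addOrderOf x ∣ n := addOrderOf_dvd_of_nsmul_eq_zero hnx
      rcases (Nat.dvd_prime hp.out).1 h1 with h | h
      · exact AddMonoid.addOrderOf_eq_one_iff.mp h
      · exact absurd (h ▸ h2) hn
    rw [hxdef, sub_eq_zero] at hx0
    exact hx0

/-- Powers act by powers of the scalar: `g P = u P` ⇒ `g^j P = u^j P`. [folklore] -/
theorem pow_smul_eq_pow_nsmul {g : G} {P : D} {u : ℕ} (hu : g • P = u • P) (j : ℕ) :
    g ^ j • P = u ^ j • P := by
  induction j with
  | zero => rw [pow_zero, pow_zero, one_smul, one_nsmul]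
  | succ j ih => rw [pow_succ, mul_smul, hu, smul_comm, ih, smul_smul, pow_succ']

/-- `p` is not `1` in `ℤ` up to sign: `natAbs p ≠ 1`. [folklore] -/
theorem natAbs_natCast_prime_ne_one : (p : ℤ).natAbs ≠ 1 := by
  rw [Int.natAbs_natCast]; exact hp.out.ne_one

/-- **(L3) `p`-power order, `p` odd:** on a `p`-divisible `p`-primary `D` with `#D[p] = p` (so every
`D[p^K]` is cyclic of order `p^K`), an automorphism `g` trivial on `D[p]` with `g^{p^a} = 1` is
trivial. (On a generator `P` of `D[p^K]`, `g P = u P` with `u ≡ 1 (mod p)` and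
`u^{p^a} ≡ 1 (mod p^K)`; lifting the exponent gives `u ≡ 1 (mod p^{K−a})`.) False for `p = 2`
(`u = −1`). [folklore] -/
theorem smul_eq_self_of_prime_pow_smul_eq_self (hp2 : p ≠ 2)
    (hD : ∀ d : D, ∃ k : ℕ, p ^ k • d = 0) (hdiv : ∀ d : D, ∃ d' : D, p • d' = d)
    (hcard : Nat.card (D[(p : ℤ)]) = p) {g : G} (htriv : ∀ x : D, p • x = 0 → g • x = x)
    {a : ℕ} (hga : ∀ d : D, g ^ (p ^ a) • d = d) (d : D) : g • d = d := by
  have hodd : Odd p := hp.out.odd_of_ne_two hp2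
  have hpℤ : Prime (p : ℤ) := Nat.prime_iff_prime_int.mp hp.out
  obtain ⟨k, hk⟩ := hD d
  rcases k with _ | k
  · rw [pow_zero, one_nsmul] at hk
    rw [hk, smul_zero]
  -- a generator `P` of `D[p^K]`, `K = k + a + 1`
  have hcard' : Nat.card ↥((⊤ : AddSubgroup D) ⊓ D[(p : ℤ)]) = p := by rw [top_inf_eq]; exact hcard
  obtain ⟨P, -, hPord, hPgen⟩ :=
    RamifiedOrdinaryLineUniqueModelFree.exists_generator_of_pDivisible_of_natCard p (⊤ : AddSubgroup D)
      hD (fun s _ ↦ by obtain ⟨s', hs'⟩ := hdiv s; exact ⟨s', trivial, hs'⟩) hcard' (k + a + 1)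
  -- `g P = u P`
  obtain ⟨u, hu⟩ := hPgen (g • P) trivial
    (by rw [smul_comm, ← hPord, addOrderOf_nsmul_eq_zero, smul_zero])
  -- (i) `u ≡ 1 (mod p)`: `Q = p^{k+a} P` has order `p` and is fixed
  set Q : D := p ^ (k + a) • P with hQdef
  have hpQ : p • Q = 0 := by
    rw [hQdef, ← mul_nsmul', ← pow_succ', ← hPord]; exact addOrderOf_nsmul_eq_zero P
  have hQ0 : Q ≠ 0 := nsmul_ne_zero_of_lt_addOrderOf (pow_ne_zero _ hp.out.ne_zero)
    (by rw [hPord]; exact Nat.pow_lt_pow_right hp.out.one_lt (Nat.lt_succ_self _))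
  have hQord : addOrderOf Q = p := addOrderOf_eq_prime hpQ hQ0
  have huQ : ((u : ℤ) - 1) • Q = 0 := by
    have h : g • Q = u • Q := by rw [hQdef, smul_comm, hu, smul_comm]
    rw [htriv Q hpQ] at h
    rw [sub_smul, one_smul, natCast_zsmul, ← h, sub_self]
  have hpu : (p : ℤ) ∣ (u : ℤ) - 1 := by
    rw [← hQord]; exact addOrderOf_dvd_iff_zsmul_eq_zero.mpr huQ
  have hpu' : ¬ (p : ℤ) ∣ (u : ℤ) := fun h ↦ by
    have h1 : (p : ℤ) ∣ 1 := by
      have := Int.dvd_sub h hpu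
      rwa [sub_sub_cancel] at this
    exact hp.out.ne_one (by exact_mod_cast Int.eq_one_of_dvd_one (Int.natCast_nonneg p) h1)
  -- (ii) `u^{p^a} ≡ 1 (mod p^K)`
  have hKdvd : (p : ℤ) ^ (k + a + 1) ∣ (u : ℤ) ^ (p ^ a) - 1 ^ (p ^ a) := by
    rw [one_pow, ← Nat.cast_pow, ← hPord]
    refine addOrderOf_dvd_iff_zsmul_eq_zero.mpr ?_
    rw [sub_smul, one_smul, ← Nat.cast_pow, natCast_zsmul, ← pow_smul_eq_pow_nsmul hu, hga P,
      sub_self]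
  -- (iii) lifting the exponent: `p^{k+1} ∣ u − 1`
  have hdvd : (p : ℤ) ^ (k + 1) ∣ (u : ℤ) - 1 := by
    by_cases hu1 : (u : ℤ) - 1 = 0
    · rw [hu1]; exact dvd_zero _
    have hle := le_emultiplicity_of_pow_dvd hKdvd
    rw [Int.emultiplicity_pow_sub_pow hp.out hodd hpu hpu' (p ^ a),
      emultiplicity_pow_self_of_prime hp.out.prime a] at hle
    have hfin : FiniteMultiplicity (p : ℤ) ((u : ℤ) - 1) :=
      Int.finiteMultiplicity_iff.mpr ⟨natAbs_natCast_prime_ne_one p, hu1⟩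
    rw [hfin.emultiplicity_eq_multiplicity, ← ENat.coe_add, ENat.coe_le_coe] at hle
    exact pow_dvd_of_le_multiplicity (by omega)
  obtain ⟨s, hs⟩ := hdvd
  -- (iv) `d = j P`, and `g d − d = j (u − 1) P = s p^{k+1} (j P) = s p^{k+1} d = 0`
  have hdK : p ^ (k + a + 1) • d = 0 := by
    rw [show k + a + 1 = a + (k + 1) by ring, pow_add, mul_nsmul', hk, nsmul_zero]
  obtain ⟨j, hj⟩ := hPgen d trivial hdK
  have hk' : ((p : ℤ) ^ (k + 1)) • d = 0 := by
    rw [← Nat.cast_pow, natCast_zsmul, hk]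
  calc g • d = (j : ℤ) • ((u : ℤ) • P) := by
        rw [hj, smul_comm, hu, natCast_zsmul, natCast_zsmul]
    _ = ((j : ℤ) * 1 + s * ((p : ℤ) ^ (k + 1) * (j : ℤ))) • P := by
        rw [smul_smul]; congr 1; linear_combination (j : ℤ) * hs
    _ = (j : ℤ) • P + s • ((p : ℤ) ^ (k + 1) • ((j : ℤ) • P)) := by
        rw [add_smul, mul_one, mul_smul, mul_smul]
    _ = d := by rw [natCast_zsmul, ← hj, hk', smul_zero, add_zero]

/-- **(L4) any finite order, `p` odd:** on a `p`-divisible `p`-primary `D` with `#D[p] = p`, an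
automorphism `g` trivial on `D[p]` with `gⁿ = 1` for some `n ≥ 1` is trivial (`n = p^a n'`:
(L2) for the prime-to-`p` part applied to `g^{p^a}`, then (L3)). This is "the torsion of
`Aut(ℚ_p/ℤ_p) = ℤ_pˣ` is `μ_{p−1}`, which acts faithfully on `D[p]`". [folklore] -/
theorem smul_eq_self_of_pow_smul_eq_self (hp2 : p ≠ 2)
    (hD : ∀ d : D, ∃ k : ℕ, p ^ k • d = 0) (hdiv : ∀ d : D, ∃ d' : D, p • d' = d)
    (hcard : Nat.card (D[(p : ℤ)]) = p) {g : G} (htriv : ∀ x : D, p • x = 0 → g • x = x)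
    {n : ℕ} (hn : n ≠ 0) (hgn : ∀ d : D, g ^ n • d = d) (d : D) : g • d = d := by
  obtain ⟨a, n', hn', rfl⟩ := Nat.exists_eq_pow_mul_and_not_dvd hn p hp.out.ne_one
  have h1 : ∀ d : D, (g ^ (p ^ a)) ^ n' • d = d := fun d ↦ by rw [← pow_mul]; exact hgn d
  have h2 : ∀ x : D, p • x = 0 → g ^ (p ^ a) • x = x := fun x hx ↦
    pow_smul_eq_self_of_smul_eq_self (htriv x hx) _
  have h3 : ∀ d : D, g ^ (p ^ a) • d = d :=
    smul_eq_self_of_pow_smul_eq_self_of_not_dvd p hD h2 hn' h1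
  exact smul_eq_self_of_prime_pow_smul_eq_self p hp2 hD hdiv hcard htriv h3 d

/-- In a group with `#D[p] = p`: an element `g` moving some `p`-torsion element moves EVERY non-zero
`p`-torsion element, i.e. `(g − 1)` is injective on `D[p]` (`D[p]` is cyclic of prime order, `g`
acts on it by a scalar `c ≠ 1`). [folklore] -/
theorem eq_zero_of_torsionBy_of_smul_eq_self (hcard : Nat.card (D[(p : ℤ)]) = p) {g : G}
    {d₁ : D} (hd₁p : p • d₁ = 0) (hgd₁ : g • d₁ ≠ d₁) {x : D} (hxp : p • x = 0)
    (hgx : g • x = x) : x = 0 := by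
  have hpℤ : Prime (p : ℤ) := Nat.prime_iff_prime_int.mp hp.out
  have hd₁ : d₁ ≠ 0 := fun h ↦ hgd₁ (by rw [h, smul_zero])
  have hcard' : Nat.card ↥((⊤ : AddSubgroup D) ⊓ D[(p : ℤ)]) = p := by rw [top_inf_eq]; exact hcard
  have hord : addOrderOf d₁ = p := addOrderOf_eq_prime hd₁p hd₁
  -- `g d₁ = c d₁`, `x = j d₁`
  obtain ⟨c, hc⟩ := RamifiedOrdinaryLineUniqueModelFree.exists_nsmul_eq_of_pTorsion_of_natCard p
    (⊤ : AddSubgroup D) hcard' trivial hd₁p hd₁ (t := g • d₁) trivial (by rw [smul_comm, hd₁p, smul_zero])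
  obtain ⟨j, rfl⟩ := RamifiedOrdinaryLineUniqueModelFree.exists_nsmul_eq_of_pTorsion_of_natCard p
    (⊤ : AddSubgroup D) hcard' trivial hd₁p hd₁ (t := x) trivial hxp
  -- `g (j d₁) = j c d₁ = j d₁` ⇒ `p ∣ j (c − 1)`
  have hzero : ((j : ℤ) * ((c : ℤ) - 1)) • d₁ = 0 := by
    rw [mul_sub, mul_one, sub_smul, mul_smul, natCast_zsmul, natCast_zsmul, ← hc, ← smul_comm, hgx,
      natCast_zsmul, sub_self]
  have hdvd : (p : ℤ) ∣ (j : ℤ) * ((c : ℤ) - 1) := by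
    rw [← hord]; exact addOrderOf_dvd_iff_zsmul_eq_zero.mpr hzero
  rcases hpℤ.dvd_or_dvd hdvd with hj | hc1
  · -- `p ∣ j`: `x = j d₁ = 0`
    rw [← natCast_zsmul, ← addOrderOf_dvd_iff_zsmul_eq_zero, hord]
    exact hj
  · -- `p ∣ c − 1`: then `g d₁ = d₁`, contradiction
    exfalso
    refine hgd₁ ?_
    have h : ((c : ℤ) - 1) • d₁ = 0 := by
      rw [← addOrderOf_dvd_iff_zsmul_eq_zero, hord]; exact hc1
    rw [sub_smul, one_smul, natCast_zsmul, ← hc, sub_eq_zero] at h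
    exact h

end Generic

end Summit.BirchSwinnertonDyer.Rank1Residual.Additive.CorankOneFiniteOrderAutomorphism

end
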